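import Mathlib.Analysis.Complex.Circle
import Mathlib.LinearAlgebra.Basis.VectorSpace
import Literature.NumberTheory.Automorphic.AutomorphicFormsProofs
import HarnessLib

/-!
# Admissibility of an automorphic representation datum is a genuine condition

`AutomorphicRepData.IsAdmissible π` (file `Literature.NumberTheory.Automorphic.AutomorphicForms`)
is a **definition** — the predicate "the `(𝔤, K_∞) × G(𝔸_f)`-module `W / W'` of the automorphic
representation datum `π` is admissible": the `G(𝔸_f)`-action `π.finiteRep` is smooth and, for
every compact open `U ≤ G(𝔸_f)`, the `K_∞`-module `(W / W')^U` has finite `K_∞`-multiplicities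
(Borel–Jacquet, Corvallis 1979, 4.5–4.6) — on an *abstract* automorphy datum
`𝒟 : AutomorphyDatum 𝒢 A N`. It is not a closed proposition awaiting discharge: `π` (and the
datum) are explicit binders, and the universal closure `∀ 𝒢 𝒟 π, π.IsAdmissible` is **false**,
because nothing in `AdelicGroupData` / `AutomorphyDatum` forces `G(𝔸_f)` to be totally
disconnected, the levels to be open, or `G` to be reductive. The *theorem* of Borel–Jacquet 4.5
("the `(𝔤, K_∞) × G(𝔸_f)`-module generated by an automorphic form is admissible", resting on
Harish-Chandra's finiteness theorem 4.3 (i)) and its corollary in 4.6 (automorphic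
representations are admissible) are vendored, for a *regular* datum satisfying Harish-Chandra's
finiteness hypothesis, as the named facts `AutomorphicRepData.isAdmissibleGK_kRepFixed` and
`AutomorphicRepData.isAdmissible_finiteRep` of `AutomorphicForms`.

This file records, fully proved:

* `AutomorphicRepData.IsAdmissible.isSmooth`, `AutomorphicRepData.IsAdmissible.isAdmissibleGK`
  (the two components), `AutomorphicRepData.isAdmissible_iff_of_isRegular` (for a regular datum
  admissibility is the finiteness of the `K_∞`-multiplicities in every `(W / W')^U`, the
  smoothness half being the discharged `AutomorphicRepData.isSmooth_finiteRep_holds` of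
  `AutomorphicFormsProofs`), and the reduction
  `AutomorphicRepData.isAdmissible_finiteRep_of_isAdmissibleGK_kRepFixed` of the BJ 4.6 fact to
  the BJ 4.5 fact;
* the non-example `AutomorphicRepData.Nonexample.circleRep`: over the junk datum
  `G(K) → G(𝔸_K) := (1 : 𝕊¹ →* 𝕊¹)`, `G(𝔸_f) := 𝕊¹` (the circle group: compact, connected, not
  discrete), `G_∞ := GL₁(ℝ)` mapped trivially, levels `{1}`, height `0`, the line `ℂ χ` spanned
  by the unitary character `χ(z) = z` is an irreducible stable subquotient `ℂ χ / 0` of the space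
  of automorphic forms (`χ` is left invariant, of level `1`, constant — hence smooth,
  `K_∞`-finite and `Z(𝔤)`-finite — in the (trivial) archimedean variable, and bounded), but the
  stabiliser of `[χ]` under right translation is `{1}`, which is not open in `𝕊¹`
  (`circle_not_isOpen_singleton_one`); so `π.finiteRep` is not smooth
  (`Nonexample.not_isSmooth_finiteRep`), `¬ circleRep.IsAdmissible`
  (`Nonexample.not_isAdmissible`), the datum is not regular (`Nonexample.not_isRegular`, by the
  discharged smoothness theorem), and `AutomorphicRepData.not_forall_isAdmissible`: the
  universal closure of the predicate is false already over `K = ℚ`, `A = ℝ`, `N = Fin 1`.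

These are the standard first remarks locating the definition (Borel–Jacquet 4.6: admissibility
of automorphic representations is a *consequence* of 4.5, i.e. of reduction theory for the
reductive group `G`, not part of the definition of a subquotient of `𝒜`); no source states them
as numbered results, so they are tagged folklore. The elementary lemmas on functions with
trivial archimedean dependence (`lieDeriv_one_hom`, `isArchSmooth_one_hom`, `isKFinite_one_hom`,
`isZFinite_one_hom`) are also folklore.

## Design notes

* The junk datum `Nonexample.circleGroupData` is a plain `def` (not an `abbrev`): the generic
  `simp` lemmas of `AutomorphicForms` are keyed on `AdelicGroupData.Adelic _` and would not fire
  on a reducible datum whose `Adelic` unfolds to `Circle`. All statements of the non-example are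
  therefore phrased over `circleGroupData.Adelic`, and the four facts about the circle that are
  used (`χ` is multiplicative, `χ 1 = 1`, `|χ| = 1`, `χ` is injective) are transported once, by
  definitional unfolding, in `Nonexample.chi_mul`, `chi_one`, `norm_chi`, `chi_injective`.

## References

* A. Borel, H. Jacquet, *Automorphic forms and automorphic representations*, Proc. Sympos. Pure
  Math. 33 (Corvallis 1977), Part 1 (1979), 189–202, 4.2, 4.3 (i), 4.5, 4.6
  [BorelJacquetCorvallis1979] (doi:10.1090/pspum/033.1/546598; not held in the literature store
  at the time of writing — statements as vendored in `AutomorphicForms`).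
* J. R. Getz, H. Hahn, *An Introduction to Automorphic Representations*, GTM 300 (2024),
  Definition 6.5, Definition 6.8 and §6.5 (admissibility of automorphic representations through
  Harish-Chandra's finiteness theorem).
-/

open scoped MatrixGroups Matrix ContDiff

noncomputable section

namespace Literature.NumberTheory.Automorphic

variable {K : Type} [Field K] [NumberField K]
variable {A : Type*} [NormedCommRing A] [NormedAlgebra ℝ A] [NormedAlgebra ℚ A] [CompleteSpace A]
  [StarRing A] {N : Type*} [Fintype N] [DecidableEq N]

/-! ## Functions with trivial archimedean dependence -/

section TrivialArch

variable {H : RealMatrixGroup A N} {G : Type*} [Group G]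

/-- Through the trivial homomorphism `1 : G_∞ →* G` every Lie derivative vanishes:
`X φ = d/dt φ (g · 1)|₀ = 0`. [folklore] -/
theorem lieDeriv_one_hom (X : H.lie) (φ : G → ℂ) : lieDeriv (1 : H.carrier →* G) X φ = 0 := by
  funext g
  simp only [lieDeriv, MonoidHom.one_apply, mul_one, Pi.zero_apply]
  exact deriv_const 0 (φ g)

/-- Through the trivial homomorphism every iterated Lie derivative of `φ` lies on the line `ℂ φ`
(it is `φ` for the empty word and `0` otherwise). [folklore] -/
theorem iterLieDeriv_one_hom_mem (w : List H.lie) (φ : G → ℂ) :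
    iterLieDeriv (1 : H.carrier →* G) w φ ∈ Submodule.span ℂ ({φ} : Set (G → ℂ)) := by
  cases w with
  | nil => exact Submodule.mem_span_singleton_self φ
  | cons X w =>
    rw [iterLieDeriv_cons, lieDeriv_one_hom]
    exact Submodule.zero_mem _

/-- Through the trivial homomorphism the word action of `ℝ⟨𝔤⟩` preserves the line `ℂ φ`.
[folklore] -/
theorem applyFree_one_hom_mem (p : FreeAlgebra ℝ H.lie) (φ : G → ℂ) :
    applyFree (1 : H.carrier →* G) p φ ∈ Submodule.span ℂ ({φ} : Set (G → ℂ)) := by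
  unfold applyFree
  exact Submodule.sum_mem _ fun w _ ↦ Submodule.smul_mem _ _ (iterLieDeriv_one_hom_mem _ φ)

/-- Through the trivial homomorphism every function is `Z(𝔤)`-finite (its `Z(𝔤)`-orbit spans
at most the line `ℂ φ`). [folklore] -/
theorem isZFinite_one_hom (φ : G → ℂ) : IsZFinite (1 : H.carrier →* G) φ := by
  unfold IsZFinite
  haveI : FiniteDimensional ℂ (Submodule.span ℂ ({φ} : Set (G → ℂ))) :=
    FiniteDimensional.span_of_finite ℂ (Set.finite_singleton φ)
  refine Submodule.finiteDimensional_of_le (S₂ := Submodule.span ℂ ({φ} : Set (G → ℂ)))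
    (Submodule.span_le.2 ?_)
  rintro _ ⟨p, -, rfl⟩
  exact applyFree_one_hom_mem p φ

/-- Through the trivial homomorphism right archimedean translation is the identity. [folklore] -/
theorem archTranslate_one_hom (h : H.carrier) (φ : G → ℂ) :
    archTranslate (1 : H.carrier →* G) h φ = φ := by
  funext g
  rw [archTranslate_apply, MonoidHom.one_apply, mul_one]

/-- Through the trivial homomorphism every function is `K_∞`-finite (all its `K_∞`-translates
coincide with it). [folklore] -/
theorem isKFinite_one_hom (φ : G → ℂ) : IsKFinite (1 : H.carrier →* G) φ := by
  unfold IsKFinite kTranslateSpan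
  haveI : FiniteDimensional ℂ (Submodule.span ℂ ({φ} : Set (G → ℂ))) :=
    FiniteDimensional.span_of_finite ℂ (Set.finite_singleton φ)
  refine Submodule.finiteDimensional_of_le (S₂ := Submodule.span ℂ ({φ} : Set (G → ℂ)))
    (Submodule.span_mono ?_)
  rintro _ ⟨k, rfl⟩
  exact archTranslate_one_hom _ φ

open scoped Matrix.Norms.Operator in
/-- Through the trivial homomorphism every function is smooth in the archimedean variable
(`X ↦ φ (g · 1)` is constant). [folklore] -/
theorem isArchSmooth_one_hom (φ : G → ℂ) : IsArchSmooth (1 : H.carrier →* G) φ := by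
  intro g
  simp only [MonoidHom.one_apply, mul_one]
  exact contDiff_const

end TrivialArch

/-! ## The two halves of admissibility -/

namespace AutomorphicRepData

variable {𝒢 : AdelicGroupData K} {𝒟 : AutomorphyDatum 𝒢 A N} (π : AutomorphicRepData 𝒟)

/-- An admissible automorphic representation datum has smooth `G(𝔸_f)`-action on `W / W'`.
Borel–Jacquet, Corvallis (1979), 4.5–4.6. [folklore] -/
theorem IsAdmissible.isSmooth {π : AutomorphicRepData 𝒟} (h : π.IsAdmissible) :
    π.finiteRep.IsSmooth :=
  h.1

/-- For an admissible automorphic representation datum the `K_∞`-module `(W / W')^U` has finite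
`K_∞`-multiplicities for every compact open `U ≤ G(𝔸_f)`.
Borel–Jacquet, Corvallis (1979), 4.5–4.6. [folklore] -/
theorem IsAdmissible.isAdmissibleGK {π : AutomorphicRepData 𝒟} (h : π.IsAdmissible)
    (U : OpenSubgroup 𝒟.finiteAdelic) (hU : IsCompact (U : Set 𝒟.finiteAdelic)) :
    IsAdmissibleGK (π.kRepFixed U) :=
  h.2 U hU

/-- For a *regular* datum the smoothness half of admissibility is automatic
(`isSmooth_finiteRep_holds`), so `π` is admissible iff every `(W / W')^U`, `U ≤ G(𝔸_f)` compact
open, has finite `K_∞`-multiplicities. Borel–Jacquet, Corvallis (1979), 4.3 and 4.5–4.6. [folklore] -/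
theorem isAdmissible_iff_of_isRegular (h𝒟 : 𝒟.IsRegular) :
    π.IsAdmissible ↔ ∀ U : OpenSubgroup 𝒟.finiteAdelic,
      IsCompact (U : Set 𝒟.finiteAdelic) → IsAdmissibleGK (π.kRepFixed U) :=
  ⟨fun h ↦ h.2, fun h ↦ ⟨π.isSmooth_finiteRep_holds h𝒟, h⟩⟩

/-- **Reduction of BJ 4.6 to BJ 4.5.** Given the finiteness of the `K_∞`-multiplicities in the
level-`U` invariants (the named fact `isAdmissibleGK_kRepFixed`, Borel–Jacquet 4.5 with
Harish-Chandra's 4.3 (i)), automorphic representations of a regular datum satisfying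
Harish-Chandra's finiteness hypothesis are admissible (the named fact `isAdmissible_finiteRep`):
the smoothness half is the discharged `isSmooth_finiteRep_holds`. This restores the packaging
proof of `AutomorphicForms` with the one remaining named fact as an explicit hypothesis.
Borel–Jacquet, Corvallis (1979), 4.5 and 4.6. [folklore] -/
theorem isAdmissible_finiteRep_of_isAdmissibleGK_kRepFixed (h : π.isAdmissibleGK_kRepFixed) :
    π.isAdmissible_finiteRep := by
  intro _ h𝒟 hfin
  exact ⟨π.isSmooth_finiteRep_holds h𝒟, fun U hU ↦ h h𝒟 hfin U hU⟩

end AutomorphicRepData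

/-! ## The non-example: a character of the circle group -/

/-- The circle group `𝕊¹ ⊂ ℂ` is not discrete: `{1}` is not open. (Its preimage under the
continuous map `t ↦ e^{it}` from the connected line would be a proper non-empty clopen subset of
`ℝ`, as `e^{iπ} ≠ 1`.) [folklore] -/
theorem circle_not_isOpen_singleton_one : ¬ IsOpen ({1} : Set Circle) := by
  intro h
  have hS : IsClopen (Circle.exp ⁻¹' ({1} : Set Circle)) :=
    ⟨isClosed_singleton.preimage Circle.exp.continuous, h.preimage Circle.exp.continuous⟩
  rcases isClopen_iff.mp hS with h0 | huniv
  · have h1 : (0 : ℝ) ∈ Circle.exp ⁻¹' ({1} : Set Circle) := by simp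
    rw [h0] at h1
    exact h1
  · have hπ : Real.pi ∈ Circle.exp ⁻¹' ({1} : Set Circle) := huniv ▸ Set.mem_univ _
    exact Circle.exp_pi_ne_one hπ

namespace AutomorphicRepData

namespace Nonexample

/-- The junk adelic group datum over `ℚ` on the circle group: `G(𝔸_K) := 𝕊¹`, `G(K) := 𝕊¹`
mapped trivially (so the arithmetic subgroup is `{1}`), `G(K_v) := 𝕊¹` with the identity
projections, `A_G := {1}`. No axiom of `AdelicGroupData` excludes it. [folklore] -/
def circleGroupData : AdelicGroupData.{0} ℚ where
  Rational := Circle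
  Adelic := Circle
  toAdelic := 1
  Local := fun _ ↦ Circle
  toLocal := fun _ ↦ MonoidHom.id Circle
  continuous_toLocal := fun _ ↦ continuous_id
  center' := ⊥
  center'_le := bot_le

/-- The diagonal map of `circleGroupData` is trivial. [folklore] -/
theorem circleGroupData_toAdelic : circleGroupData.toAdelic = 1 := rfl

/-- The junk automorphy datum on `circleGroupData`: `G_∞ := GL₁(ℝ)` mapped trivially into
`G(𝔸_K) = 𝕊¹`, `G(𝔸_f) := 𝕊¹` (all of `G(𝔸_K)`), the single level `{1}`, height `0`.
No axiom of `AutomorphyDatum` excludes it (it is not *regular*: `not_isRegular`). [folklore] -/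
def circleDatum : AutomorphyDatum circleGroupData ℝ (Fin 1) where
  arch := RealMatrixGroup.gl ℝ (Fin 1)
  ofArch := 1
  continuous_ofArch := continuous_const.congr fun _ ↦ (MonoidHom.one_apply _).symm
  finiteAdelic := ⊤
  commute_ofArch := fun g h _ ↦ by rw [MonoidHom.one_apply, one_mul, mul_one]
  finiteLevels := {⊥}
  finiteLevels_nonempty := ⟨⊥, rfl⟩
  le_finiteAdelic := fun _ _ ↦ le_top
  height := 0

/-- The archimedean inclusion of `circleDatum` is trivial. [folklore] -/
theorem circleDatum_ofArch : circleDatum.ofArch = 1 := rfl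

/-- The inclusion of `K_∞` of `circleDatum` is trivial. [folklore] -/
theorem circleDatum_ofK (k : circleDatum.arch.maximalCompact) : circleDatum.ofK k = 1 := rfl

/-- `G(𝔸_f)` of `circleDatum` is all of `G(𝔸_K) = 𝕊¹`. [folklore] -/
theorem circleDatum_finiteAdelic : circleDatum.finiteAdelic = ⊤ := rfl

/-- The levels of `circleDatum` are `{1}` only. [folklore] -/
theorem circleDatum_finiteLevels : circleDatum.finiteLevels = {⊥} := rfl

/-- The height of `circleDatum` is `0`. [folklore] -/
theorem circleDatum_height (g : circleGroupData.Adelic) : circleDatum.height g = 0 := rfl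

/-- The unitary character `χ(z) = z` of the circle group `G(𝔸_K) = 𝕊¹ ⊂ ℂ`. [folklore] -/
def chi : circleGroupData.Adelic → ℂ := fun z ↦ Subtype.val z

/-- `χ` is multiplicative. [folklore] -/
theorem chi_mul (g h : circleGroupData.Adelic) : chi (g * h) = chi g * chi h := Circle.coe_mul g h

/-- `χ 1 = 1`. [folklore] -/
theorem chi_one : chi 1 = 1 := Circle.coe_one

/-- `|χ z| = 1`. [folklore] -/
theorem norm_chi (z : circleGroupData.Adelic) : ‖chi z‖ = 1 := Circle.norm_coe z

/-- `χ` is injective. [folklore] -/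
theorem chi_injective : Function.Injective chi := Circle.coe_injective

/-- `χ ≠ 0` (`χ 1 = 1`). [folklore] -/
theorem chi_ne_zero : chi ≠ 0 := fun h ↦ by
  have h1 : chi 1 = 0 := congr_fun h 1
  rw [chi_one] at h1
  exact one_ne_zero h1

/-- Right translation acts on the character `χ` by the scalar `χ(h)`: `r(h) χ = χ(h) χ`. [folklore] -/
theorem rightTranslation_chi (h : circleGroupData.Adelic) :
    rightTranslation circleGroupData h chi = chi h • chi := by
  funext g
  rw [rightTranslation_apply, Pi.smul_apply, smul_eq_mul, chi_mul, mul_comm]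

/-- The line `ℂ χ` is stable under right translation. [folklore] -/
theorem rightTranslation_mem_span_chi {φ : circleGroupData.Adelic → ℂ}
    (hφ : φ ∈ Submodule.span ℂ ({chi} : Set (circleGroupData.Adelic → ℂ)))
    (h : circleGroupData.Adelic) :
    rightTranslation circleGroupData h φ ∈
      Submodule.span ℂ ({chi} : Set (circleGroupData.Adelic → ℂ)) := by
  obtain ⟨c, rfl⟩ := Submodule.mem_span_singleton.mp hφ
  rw [map_smul, rightTranslation_chi, smul_smul]
  exact Submodule.smul_mem _ _ (Submodule.mem_span_singleton_self chi)

/-- `χ` is an automorphic form for `circleDatum`: left invariant under the (trivial) arithmetic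
subgroup, of level `{1}`, constant — hence smooth, `K_∞`-finite and `Z(𝔤)`-finite — in the
trivial archimedean variable, and bounded (moderate growth with `C = 1`, `r = 0`). [folklore] -/
theorem isAutomorphicForm_chi : IsAutomorphicForm circleDatum chi where
  leftInvariant := by
    rintro γ ⟨x, rfl⟩ g
    rw [circleGroupData_toAdelic, MonoidHom.one_apply, one_mul]
  exists_level := ⟨⊥, rfl, fun u hu g ↦ by rw [Subgroup.mem_bot] at hu; rw [hu, mul_one]⟩
  archSmooth := by
    rw [circleDatum_ofArch]
    exact isArchSmooth_one_hom chi
  kFinite := by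
    rw [circleDatum_ofArch]
    exact isKFinite_one_hom chi
  zFinite := by
    rw [circleDatum_ofArch]
    exact isZFinite_one_hom chi
  moderateGrowth := ⟨1, 0, fun g ↦ by rw [pow_zero, mul_one, norm_chi]⟩

/-- The line `ℂ χ` is a stable subspace of the automorphic forms of `circleDatum`. [folklore] -/
theorem isStableSubmodule_span_chi :
    IsStableSubmodule circleDatum (Submodule.span ℂ ({chi} : Set (circleGroupData.Adelic → ℂ)))
    where
  le_automorphicForms := Submodule.span_mono (Set.singleton_subset_iff.2 isAutomorphicForm_chi)
  finite_stable := fun h _ φ hφ ↦ rightTranslation_mem_span_chi hφ h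
  k_stable := fun k φ hφ ↦ by
    rw [Submodule.mem_comap, circleDatum_ofK, map_one, Module.End.one_apply]
    exact hφ
  lie_stable := fun X φ _ ↦ by
    rw [circleDatum_ofArch, lieDeriv_one_hom]
    exact Submodule.zero_mem _

/-- The zero subspace is stable (for `circleDatum`). [folklore] -/
theorem isStableSubmodule_bot :
    IsStableSubmodule circleDatum (⊥ : Submodule ℂ (circleGroupData.Adelic → ℂ)) where
  le_automorphicForms := bot_le
  finite_stable := fun _ _ ↦ bot_le
  k_stable := fun _ ↦ bot_le
  lie_stable := fun X φ _ ↦ by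
    rw [circleDatum_ofArch, lieDeriv_one_hom]
    exact Submodule.zero_mem _

/-- `ℂ χ ≠ 0`. [folklore] -/
theorem span_chi_ne_bot : Submodule.span ℂ ({chi} : Set (circleGroupData.Adelic → ℂ)) ≠ ⊥ := by
  rw [Ne, Submodule.span_singleton_eq_bot]
  exact chi_ne_zero

/-- **The non-example.** The automorphic representation datum `ℂ χ / 0` of `circleDatum`: the
line `ℂ χ` is stable and simple (a line has no subspaces other than `0` and itself,
`nonzero_span_atom`), so `ℂ χ / 0` is an irreducible stable subquotient of the space of
automorphic forms. [folklore] -/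
def circleRep : AutomorphicRepData circleDatum where
  W := Submodule.span ℂ ({chi} : Set (circleGroupData.Adelic → ℂ))
  W' := ⊥
  lt := bot_lt_iff_ne_bot.2 span_chi_ne_bot
  stable := isStableSubmodule_span_chi
  stable' := isStableSubmodule_bot
  irreducible := fun _ _ hle _ ↦ (nonzero_span_atom chi chi_ne_zero).le_iff.mp hle

/-- `circleRep.W = ℂ χ`. [folklore] -/
theorem circleRep_W :
    circleRep.W = Submodule.span ℂ ({chi} : Set (circleGroupData.Adelic → ℂ)) := rfl

/-- `circleRep.W' = 0`. [folklore] -/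
theorem circleRep_W' : circleRep.W' = ⊥ := rfl

/-- `χ ∈ W`. [folklore] -/
theorem chi_mem_W : chi ∈ circleRep.W := Submodule.mem_span_singleton_self chi

/-- The vector `[χ] ∈ W / W' = ℂ χ / 0`. [folklore] -/
def v₀ : circleRep.Quot := Submodule.Quotient.mk ⟨chi, chi_mem_W⟩

/-- In `W / 0` two classes agree iff the underlying functions agree. [folklore] -/
theorem mk_eq_mk_iff (φ ψ : circleRep.W) :
    (Submodule.Quotient.mk φ : circleRep.Quot) = Submodule.Quotient.mk ψ ↔
      (φ : circleGroupData.Adelic → ℂ) = ψ := by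
  rw [Submodule.Quotient.eq]
  change φ - ψ ∈ circleRep.W'.comap circleRep.W.subtype ↔ _
  rw [Submodule.mem_comap, circleRep_W', Submodule.mem_bot, map_sub, sub_eq_zero]
  exact Iff.rfl

/-- `h ∈ G(𝔸_f) = 𝕊¹` fixes `[χ]` iff `h = 1` (`r(h) χ = χ(h) χ` and `χ` is injective). [folklore] -/
theorem finiteRep_v₀_eq_iff (h : circleDatum.finiteAdelic) :
    circleRep.finiteRep h v₀ = v₀ ↔ h = 1 := by
  unfold v₀
  rw [finiteRep_mk, mk_eq_mk_iff]
  change rightTranslation circleGroupData (h : circleGroupData.Adelic) chi = chi ↔ h = 1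
  rw [rightTranslation_chi]
  constructor
  · intro hh
    have h1 : chi h * chi 1 = chi 1 := congr_fun hh 1
    rw [chi_one, mul_one] at h1
    exact Subtype.ext (chi_injective (h1.trans chi_one.symm))
  · rintro rfl
    change chi 1 • chi = chi
    rw [chi_one, one_smul]

/-- The stabiliser of `[χ]` in `G(𝔸_f) = 𝕊¹` is `{1}`. [folklore] -/
theorem coe_stabilizerSubgroup_v₀ :
    (circleRep.finiteRep.stabilizerSubgroup v₀ : Set circleDatum.finiteAdelic) = {1} := by
  ext h
  rw [SetLike.mem_coe, Representation.mem_stabilizerSubgroup, finiteRep_v₀_eq_iff,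
    Set.mem_singleton_iff]

/-- `[χ]` is not a smooth vector: its stabiliser `{1}` is not open in `𝕊¹`. [folklore] -/
theorem not_isSmoothVector_v₀ : ¬ circleRep.finiteRep.IsSmoothVector v₀ := by
  intro h
  rw [Representation.IsSmoothVector, coe_stabilizerSubgroup_v₀] at h
  have hf : Continuous fun z : circleGroupData.Adelic ↦
      (⟨z, Subgroup.mem_top z⟩ : circleDatum.finiteAdelic) :=
    continuous_id.subtype_mk _
  have h1 : IsOpen ({1} : Set circleGroupData.Adelic) := by
    convert h.preimage hf using 1
    ext z
    simp only [Set.mem_singleton_iff, Set.mem_preimage]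
    exact ⟨fun hz ↦ Subtype.ext hz, fun hz ↦ congrArg Subtype.val hz⟩
  exact circle_not_isOpen_singleton_one h1

/-- The `G(𝔸_f)`-action on `ℂ χ / 0` is **not smooth**. [folklore] -/
theorem not_isSmooth_finiteRep : ¬ circleRep.finiteRep.IsSmooth :=
  fun h ↦ not_isSmoothVector_v₀ (h v₀)

/-- The automorphic representation datum `ℂ χ / 0` is **not admissible**. [folklore] -/
theorem not_isAdmissible : ¬ circleRep.IsAdmissible :=
  fun h ↦ not_isSmooth_finiteRep h.isSmooth

/-- The junk datum is not regular (for a regular datum the `G(𝔸_f)`-action on every `W / W'` is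
smooth, `isSmooth_finiteRep_holds`); so the non-example does not contradict Borel–Jacquet 4.5–4.6
(`isAdmissible_finiteRep`). [folklore] -/
theorem not_isRegular : ¬ circleDatum.IsRegular :=
  fun h ↦ not_isSmooth_finiteRep (circleRep.isSmooth_finiteRep_holds h)

end Nonexample

/-- `AutomorphicRepData.IsAdmissible` is a proper predicate (the *definition* of an admissible
`(𝔤, K_∞) × G(𝔸_f)`-subquotient of the space of automorphic forms of an abstract automorphy
datum), not a theorem: its universal closure is false already over `K = ℚ`, `A = ℝ`,
`N = Fin 1` (witness `Nonexample.circleRep`, the character `χ(z) = z` of the circle group viewed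
as `G(𝔸_f)`, whose `G(𝔸_f)`-action is not smooth). The theorem of Borel–Jacquet 4.5–4.6 —
automorphic representations of a connected *reductive* group are admissible — is the named fact
`AutomorphicRepData.isAdmissible_finiteRep` (regular datum, Harish-Chandra finiteness), reduced
to `isAdmissibleGK_kRepFixed` by `isAdmissible_finiteRep_of_isAdmissibleGK_kRepFixed`. [folklore] -/
theorem not_forall_isAdmissible :
    ¬ ∀ (𝒢 : AdelicGroupData.{0} ℚ) (𝒟 : AutomorphyDatum 𝒢 ℝ (Fin 1))
        (π : AutomorphicRepData 𝒟), π.IsAdmissible :=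
  fun h ↦ Nonexample.not_isAdmissible (h _ _ Nonexample.circleRep)

end AutomorphicRepData

end Literature.NumberTheory.Automorphic
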